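import Mathlib.MeasureTheory.Integral.Pi
import Mathlib.MeasureTheory.Integral.Prod
import Literature.MathematicalPhysics.QuantumFieldTheory.Balaban1983to89.T4ShellMeasure
import Literature.MathematicalPhysics.QuantumFieldTheory.Balaban1983to89.T4LipschitzLedger

/-!
# YM-DAG node N21 (= NE7c) — THE THRESHOLD MIXTURE OF PRINT'S SHARP PROCEDURE, PART 1: design (η)'s profile factor IS the λ-average of the
# SHARP indicator over per-occurrence thresholds `s ∈ [(1 − κ)θ, θ]`; the wall (M1) `T4ShellMeasure.SlotAntiConcentration` HOLDS for the
# mixture measure by Fubini in the threshold (ANY field law); the per-term product identity; and the linear transports of single-run facts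

Track A of `YM-PLAN.md` (cell `pub-ymgap`, HUMAN RULING D-0062), node **N21**; R141 (C) fan-out seat `pub-ymgap-dag-n21-e` (strategy s3 =
ALTERNATIVE CURRENCY), generation 2, file 5a (files 1–4 = p453165 `…N21AtSpineCarriersProfiled`, p454939 `…ProfiledRealized`, p459145
`…ProfiledThresholdSync`, p460662 `…ProfiledThresholdSyncSanity`: design (η) «Lipschitz cut-off profiles» read at the K5 stub; file 5b
`…N21ThresholdMixtureRepr` = the constructor `termRepr_of_sharpMixture`).  This file executes ROW A (α) of the lens memo
`ym-lens-BalabanUVNodes-nearmiss/LENS-nearmiss.md` v2.0 §2 Card 5 ∕ §4 (pub-ymgap INBOX l.13275; dag-lead DEDUP-179 l.13306, GO after l.13562).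
Kernel bookkeeping + Fubini: 0 `def`, 0 `sorry`, standard axioms.  COUNT-NEUTRAL; `--supports` the K3′ item `SpineGivenEndpointR12` as a helper.

CREDIT.  §1 below (five theorems) was TYPED AND FARM-PROVED by the planner LENS seat `ym-lens-BalabanUVNodes-nearmiss` (gen 2) as the memo
sketch `Sketch-nearmiss-g2.lean` (sha16 d40ec7c00804fa92, ns `YMLens.NearMissN21G2`, 2026-08-26T18:54Z); that seat has no ledger writes by
instruction, so this prover seat lands the five statements VERBATIM (proofs unchanged up to namespace ∕ `open` lines) with this attribution.
§2 is this seat's.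

HONEST FRAMING.  NE7c (`T4IndicatorShell.ShellWeightBound`) is NOT PRINTED in [Bałaban 1983–89] and NOT PROVED; the manuscripts construct
ONE run with thresholds fixed once.  The THRESHOLD MIXTURE is a cell device (lens Card 5): every OCCURRENCE of a background-mediated
characteristic function gets its own threshold `s = λθ`, `λ` uniform on `[1 − κ_a, 1]` INSIDE print's ladder slack, the run is print's SHARP
procedure at each `λ`, and the carriers compared by node U5 are the `λ`-AVERAGES.  What this buys, as kernel sentences: (i) the averaged slot
factor IS the (η) profile factor `linProfile κ (u∕θ)` (§1), so design (η)'s realized ledger `T4LipschitzLedger.TermRepr` is INSTANTIATED BY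
THE EXISTING SHARP REPRESENTATION (file 5b) — no second, profiled tower of record; (ii) the wall (M1) `SlotAntiConcentration` HOLDS for the
mixture slot measure `μ ⊗ Leb|[(1−κ)θ, θ]` with `D = ((1 − ρ)κ)⁻¹`, for ANY field law `μ` (§1, Fubini in the threshold); (iii) every
single-run inequality of print that holds UNIFORMLY over the threshold box passes to the mixture by linearity and monotonicity of the
average (§2).  What it does NOT do: it is not print's construction verbatim (a convex combination of print's procedure over admissible
threshold vectors); it is not (M1) for the deterministic sharp procedure at print's fixed thresholds; the located inputs stay DISPLAYED —
(O-mix-1) the record's sharp terms have the threshold-free shape `hXs` of file 5b (NODE O at the Stage-12 record; def-T∕def-χ typing question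
«is the threshold a free argument of `Node00.chiOfRecord`, read nowhere else?» — the cheapest falsifier (K-ii) of the card), (O-mix-2)
`T4LipschitzLedger.SupClose` (N16, (F∞)) and `T4LipschitzCutoff.SiblingSuppression` (N20, NE7b species) UNIFORM over multipliers in
`[1 − κ_a, 1]` (`T4LipschitzCutoff` §5∕§7 is exactly that worst case), (O-mix-3) ONE multiplier parameter per OCCURRENCE (per-level
randomisation is the dead variant, lens census p).  N16 ∕ N20 untouched; N21 NOT discharged; one finite four-torus programme at fixed `ε`;
NOT continuum ∕ ℝ⁴ ∕ OS ∕ mass gap ∕ Clay.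

CITATION HEADER (lean-in-tree rule 2026-08-18).  Everything BY NAME from the tree: `T4IndicatorShell.smallInd` (:226), `T4LipschitzCutoff.linProfile`
(:299) ∕ `linProfile_lipProfile` (:303), `T4LipschitzLedger.Pol` ∕ `Pol.fac` ∕ `facAt` (:299) ∕ `TermRepr` (:485), `T4ShellMeasure.SlotAntiConcentration`
(:598); Mathlib `Measure.prod_apply`, `Measure.prod_prod`, `Real.volume_Icc∕Ioc`, `integral_indicator_one`, `integral_fintype_prod_eq_prod`,
`integral_finsetSum`, `integral_mono_ae`.  Context only (SHAPE, no sentence a hypothesis): [Balaban1988Convergent] (2.17)∕(2.18) p. 257 (one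
sharp small-field slot per cube; the density as a sum of terms); [Balaban1989LargeFieldI] (1.22) p. 181 (the printed threshold LADDER is
deliberately non-sharp — the slack the multipliers live in) and p. 193 «All the above transformations preserve the k^{th} density ρ_k, they
change only the representation of this density.»

WHAT IS PROVED ([folklore]).
§1 (lens, verbatim): `linProfile_eq_thresholdAverage` · `thresholdMixture_shell_le` · `slotAntiConcentration_thresholdMixture` ·
   `integral_fac_smallInd` · `sharpMixture_prod_eq_profile_prod`.
§2 (transports, this seat): `integral_sum_le_of_forall` · `relBound_mixture_of_forall` (a relative class bound `Σ_{Bad} Xs ≤ W·Σ_T Xs`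
   holding for (almost) EVERY threshold vector passes to the λ-averages — the `T4WeightBudget.RelWeightBound`-shaped field of the mixture
   carriers) · `mixture_le_of_forall_le` (a pointwise bound passes to the normalised average).
-/

set_option autoImplicit false

noncomputable section

open MeasureTheory Set
open scoped BigOperators ENNReal

namespace Summit.QuantumFields.YangMills.Theorems.N21ThresholdMixture

open Literature.MathematicalPhysics.QuantumFieldTheory.Balaban1983to89
open Literature.MathematicalPhysics.QuantumFieldTheory.Balaban1983to89.T4LipschitzCutoff
open Literature.MathematicalPhysics.QuantumFieldTheory.Balaban1983to89.T4ShellMeasure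
open Literature.MathematicalPhysics.QuantumFieldTheory.Balaban1983to89.T4IndicatorShell
open Literature.MathematicalPhysics.QuantumFieldTheory.Balaban1983to89.T4LipschitzLedger

/-! ## §1 The lens lemmas (ym-lens-BalabanUVNodes-nearmiss g2, `Sketch-nearmiss-g2.lean`, landed verbatim) -/

/-- **PROFILE = THRESHOLD-AVERAGE OF SHARP INDICATORS.**  For `0 < κ`, `θ > 0` and any `u`:
`linProfile κ (u/θ) = (κθ)⁻¹ · |{s ∈ [(1 − κ)θ, θ] : u < s}|` — the piecewise-linear (η) profile IS the average of the SHARP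
small-field indicators `1[u < s]` over thresholds `s` uniform in `[(1 − κ)θ, θ]`.  (Typed and proved by the lens seat
`ym-lens-BalabanUVNodes-nearmiss` g2; landed verbatim.) [folklore] -/
theorem linProfile_eq_thresholdAverage {κ θ : ℝ} (hκ0 : 0 < κ) (hθ : 0 < θ) (u : ℝ) :
    linProfile κ (u / θ) = (κ * θ)⁻¹ * (volume (Icc ((1 - κ) * θ) θ ∩ Ioi u)).toReal := by
  have hθa : θ - (1 - κ) * θ = κ * θ := by ring
  unfold linProfile
  rcases lt_or_ge u ((1 - κ) * θ) with hua | hua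
  · -- below the lowered threshold: the whole interval, profile value 1
    have hset : Icc ((1 - κ) * θ) θ ∩ Ioi u = Icc ((1 - κ) * θ) θ :=
      inter_eq_left.2 fun s hs => hua.trans_le hs.1
    rw [hset, Real.volume_Icc, hθa, ENNReal.toReal_ofReal (mul_pos hκ0 hθ).le,
      inv_mul_cancel₀ (mul_pos hκ0 hθ).ne']
    have h : 1 ≤ (1 - u / θ) / κ := by
      rw [le_div_iff₀ hκ0, one_mul]
      have : u / θ < 1 - κ := by rw [div_lt_iff₀ hθ]; exact hua
      linarith
    rw [min_eq_left h, max_eq_right zero_le_one]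
  · rcases lt_or_ge u θ with huθ | huθ
    · -- inside the layer: the part of the interval above `u`, profile value `(1 − u/θ)/κ`
      have hset : Icc ((1 - κ) * θ) θ ∩ Ioi u = Ioc u θ := by
        ext s
        constructor
        · rintro ⟨⟨-, h2⟩, h3⟩
          exact ⟨h3, h2⟩
        · rintro ⟨h1, h2⟩
          exact ⟨⟨hua.trans h1.le, h2⟩, h1⟩
      rw [hset, Real.volume_Ioc, ENNReal.toReal_ofReal (by linarith : 0 ≤ θ - u)]
      have h0 : 0 ≤ (1 - u / θ) / κ := by
        apply div_nonneg _ hκ0.le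
        rw [sub_nonneg, div_le_one hθ]
        exact huθ.le
      have h1 : (1 - u / θ) / κ ≤ 1 := by
        rw [div_le_one hκ0]
        have : 1 - κ ≤ u / θ := by rw [le_div_iff₀ hθ]; exact hua
        linarith
      rw [min_eq_right h1, max_eq_right h0]
      field_simp
    · -- above the threshold: empty, profile value 0
      have hset : Icc ((1 - κ) * θ) θ ∩ Ioi u = ∅ := by
        ext s
        simp only [mem_inter_iff, mem_Icc, mem_Ioi, mem_empty_iff_false, iff_false]
        rintro ⟨⟨-, h2⟩, h3⟩
        exact absurd (h3.trans_le h2) (not_lt.2 huθ)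
      rw [hset, measure_empty, ENNReal.toReal_zero, mul_zero]
      have h : (1 - u / θ) / κ ≤ 0 :=
        div_nonpos_of_nonpos_of_nonneg (by rw [sub_nonpos, one_le_div hθ]; exact huθ) hκ0.le
      rw [min_eq_right (h.trans zero_le_one), max_eq_left h]

section Wall

variable {X : Type*} [MeasurableSpace X]

/-- **(M1) IN THE THRESHOLD DIRECTION, BY FUBINI.**  For any measure `μ` on the term's space, any measurable tested variable `u`,
`0 ≤ ρ < 1`, any `θ` and any `a`: the `μ ⊗ Leb|[a, θ]`-measure of the MOVING shell `{(x, s) : s(1 − ρ) ≤ u x < s}` is at most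
`θρ/(1 − ρ) · μ(univ)` — each `x`-section is an interval of length `u(x)ρ/(1 − ρ) ≤ θρ/(1 − ρ)` (or empty when `u x ≥ θ`).
Nothing about `μ` is used.  (Lens seat g2; landed verbatim.) [folklore] -/
theorem thresholdMixture_shell_le (μ : Measure X) {u : X → ℝ} (hu : Measurable u) {θ ρ a : ℝ}
    (hρ0 : 0 ≤ ρ) (hρ1 : ρ < 1) :
    (μ.prod (volume.restrict (Icc a θ))) {p : X × ℝ | p.2 * (1 - ρ) ≤ u p.1 ∧ u p.1 < p.2}
      ≤ ENNReal.ofReal (θ * ρ / (1 - ρ)) * μ univ := by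
  have h1ρ : 0 < 1 - ρ := by linarith
  have hS : MeasurableSet {p : X × ℝ | p.2 * (1 - ρ) ≤ u p.1 ∧ u p.1 < p.2} :=
    (measurableSet_le (measurable_snd.mul_const _) (hu.comp measurable_fst)).inter
      (measurableSet_lt (hu.comp measurable_fst) measurable_snd)
  rw [Measure.prod_apply hS]
  have hpt : ∀ x, (volume.restrict (Icc a θ))
      (Prod.mk x ⁻¹' {p : X × ℝ | p.2 * (1 - ρ) ≤ u p.1 ∧ u p.1 < p.2}) ≤ ENNReal.ofReal (θ * ρ / (1 - ρ)) := by
    intro x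
    by_cases hx : u x < θ
    · calc (volume.restrict (Icc a θ)) (Prod.mk x ⁻¹' {p : X × ℝ | p.2 * (1 - ρ) ≤ u p.1 ∧ u p.1 < p.2})
            ≤ volume (Prod.mk x ⁻¹' {p : X × ℝ | p.2 * (1 - ρ) ≤ u p.1 ∧ u p.1 < p.2}) :=
              Measure.restrict_apply_le _ _
        _ ≤ volume (Icc (u x) (u x / (1 - ρ))) := by
              refine measure_mono fun s hs => ?_
              simp only [mem_preimage, mem_setOf_eq] at hs
              exact ⟨hs.2.le, by rw [le_div_iff₀ h1ρ]; exact hs.1⟩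
        _ = ENNReal.ofReal (u x / (1 - ρ) - u x) := Real.volume_Icc
        _ ≤ ENNReal.ofReal (θ * ρ / (1 - ρ)) := by
              apply ENNReal.ofReal_le_ofReal
              have hrw : u x / (1 - ρ) - u x = u x * ρ / (1 - ρ) := by
                field_simp
                ring
              rw [hrw]
              exact div_le_div_of_nonneg_right (mul_le_mul_of_nonneg_right hx.le hρ0) h1ρ.le
    · have hempty : Prod.mk x ⁻¹' {p : X × ℝ | p.2 * (1 - ρ) ≤ u p.1 ∧ u p.1 < p.2} ∩ Icc a θ = ∅ := by
        ext s
        simp only [mem_inter_iff, mem_preimage, mem_setOf_eq, mem_Icc, mem_empty_iff_false, iff_false]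
        rintro ⟨⟨-, h2⟩, -, h3⟩
        exact hx (h2.trans_le h3)
      rw [Measure.restrict_apply' measurableSet_Icc, hempty, measure_empty]
      exact bot_le
  calc ∫⁻ x, (volume.restrict (Icc a θ))
          (Prod.mk x ⁻¹' {p : X × ℝ | p.2 * (1 - ρ) ≤ u p.1 ∧ u p.1 < p.2}) ∂μ
      ≤ ∫⁻ _x, ENNReal.ofReal (θ * ρ / (1 - ρ)) ∂μ := lintegral_mono hpt
    _ = ENNReal.ofReal (θ * ρ / (1 - ρ)) * μ univ := lintegral_const _

/-- **THE WALL (M1) HOLDS FOR THE THRESHOLD MIXTURE.**  For any measure `μ`, measurable `u`, `θ > 0`, `0 ≤ ρ < 1`, `0 < κ < 1`: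
`T4ShellMeasure.SlotAntiConcentration` holds for the product of `μ` with Lebesgue measure on the threshold interval `[(1 − κ)θ, θ]`, the
rescaled tested variable `(x, s) ↦ θ·u(x)/s` (whose shell below `θ` of relative width `ρ` is exactly the moving shell `s(1 − ρ) ≤ u < s`),
and the constant `D = (1 − ρ)⁻¹κ⁻¹` — independent of `K`, of the level, and of `μ`.  (Lens seat g2; landed verbatim.) [folklore] -/
theorem slotAntiConcentration_thresholdMixture (μ : Measure X) {u : X → ℝ} (hu : Measurable u)
    {θ ρ κ : ℝ} (hθ : 0 < θ) (hρ0 : 0 ≤ ρ) (hρ1 : ρ < 1) (hκ0 : 0 < κ) (hκ1 : κ < 1) :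
    SlotAntiConcentration (μ.prod (volume.restrict (Icc ((1 - κ) * θ) θ)))
      (fun p : X × ℝ => θ * u p.1 / p.2) θ ρ ((1 - ρ)⁻¹ * κ⁻¹) := by
  have h1ρ : 0 < 1 - ρ := by linarith
  have ha0 : 0 < (1 - κ) * θ := mul_pos (by linarith) hθ
  unfold SlotAntiConcentration
  -- the shell of the rescaled variable, off a null set, is the moving shell
  have hsub : {p : X × ℝ | θ * (1 - ρ) ≤ θ * u p.1 / p.2 ∧ θ * u p.1 / p.2 < θ}
      ⊆ {p : X × ℝ | p.2 * (1 - ρ) ≤ u p.1 ∧ u p.1 < p.2} ∪ univ ×ˢ (Icc ((1 - κ) * θ) θ)ᶜ := by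
    intro p hp
    by_cases hp2 : p.2 ∈ Icc ((1 - κ) * θ) θ
    · left
      have hs0 : 0 < p.2 := ha0.trans_le hp2.1
      simp only [mem_setOf_eq] at hp ⊢
      obtain ⟨hpa, hpb⟩ := hp
      rw [le_div_iff₀ hs0] at hpa
      rw [div_lt_iff₀ hs0] at hpb
      constructor
      · nlinarith
      · nlinarith
    · right
      exact ⟨mem_univ _, hp2⟩
  have hnull : (μ.prod (volume.restrict (Icc ((1 - κ) * θ) θ))) (univ ×ˢ (Icc ((1 - κ) * θ) θ)ᶜ) = 0 := by
    rw [Measure.prod_prod, Measure.restrict_apply' measurableSet_Icc, compl_inter_self, measure_empty, mul_zero]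
  have huniv : (μ.prod (volume.restrict (Icc ((1 - κ) * θ) θ))) univ = μ univ * ENNReal.ofReal (κ * θ) := by
    rw [← univ_prod_univ, Measure.prod_prod, Measure.restrict_apply' measurableSet_Icc, univ_inter, Real.volume_Icc]
    congr 2
    ring
  have hc0 : 0 ≤ (1 - ρ)⁻¹ * κ⁻¹ * ρ := by positivity
  have key : ENNReal.ofReal (θ * ρ / (1 - ρ)) * μ univ
      = ENNReal.ofReal ((1 - ρ)⁻¹ * κ⁻¹ * ρ) * (μ.prod (volume.restrict (Icc ((1 - κ) * θ) θ))) univ := by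
    rw [huniv, mul_comm (μ univ) _, ← mul_assoc, ← ENNReal.ofReal_mul hc0]
    congr 2
    field_simp
  calc (μ.prod (volume.restrict (Icc ((1 - κ) * θ) θ)))
          {p : X × ℝ | θ * (1 - ρ) ≤ θ * u p.1 / p.2 ∧ θ * u p.1 / p.2 < θ}
      ≤ (μ.prod (volume.restrict (Icc ((1 - κ) * θ) θ)))
          ({p : X × ℝ | p.2 * (1 - ρ) ≤ u p.1 ∧ u p.1 < p.2} ∪ univ ×ˢ (Icc ((1 - κ) * θ) θ)ᶜ) :=
        measure_mono hsub
    _ ≤ (μ.prod (volume.restrict (Icc ((1 - κ) * θ) θ))) {p : X × ℝ | p.2 * (1 - ρ) ≤ u p.1 ∧ u p.1 < p.2}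
        + (μ.prod (volume.restrict (Icc ((1 - κ) * θ) θ))) (univ ×ˢ (Icc ((1 - κ) * θ) θ)ᶜ) :=
        measure_union_le _ _
    _ = (μ.prod (volume.restrict (Icc ((1 - κ) * θ) θ))) {p : X × ℝ | p.2 * (1 - ρ) ≤ u p.1 ∧ u p.1 < p.2} := by
        rw [hnull, add_zero]
    _ ≤ ENNReal.ofReal (θ * ρ / (1 - ρ)) * μ univ := thresholdMixture_shell_le μ hu hρ0 hρ1
    _ = _ := key

end Wall

/-- **ONE SHARP SLOT FACTOR, AVERAGED OVER ITS THRESHOLD, IS THE (η) PROFILE FACTOR** (either polarity of `T4LipschitzLedger.Pol`):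
`∫_{s ∈ [(1 − κ)θ, θ]} fac(1[u < s]) ds = κθ · fac(linProfile κ (u/θ))`.  (Lens seat g2; landed verbatim.) [folklore] -/
theorem integral_fac_smallInd (p : Pol) {κ θ : ℝ} (hκ0 : 0 < κ) (hθ : 0 < θ) (u : ℝ) :
    ∫ s in Icc ((1 - κ) * θ) θ, p.fac (smallInd u s) = κ * θ * p.fac (linProfile κ (u / θ)) := by
  have hκθ : 0 < κ * θ := mul_pos hκ0 hθ
  have hθa : θ - (1 - κ) * θ = κ * θ := by ring
  have hind : (fun s => smallInd u s) = (Ioi u).indicator (1 : ℝ → ℝ) := by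
    ext s
    simp [smallInd, Set.indicator_apply, mem_Ioi]
  have hsmall : ∫ s in Icc ((1 - κ) * θ) θ, smallInd u s = κ * θ * linProfile κ (u / θ) := by
    rw [hind, integral_indicator_one measurableSet_Ioi, measureReal_def,
      Measure.restrict_apply measurableSet_Ioi, inter_comm, linProfile_eq_thresholdAverage hκ0 hθ,
      ← mul_assoc, mul_inv_cancel₀ hκθ.ne', one_mul]
  cases p with
  | small => simpa using hsmall
  | large =>
    have hint : Integrable (fun s => smallInd u s) (volume.restrict (Icc ((1 - κ) * θ) θ)) := by
      rw [hind]
      exact (integrable_indicator_iff measurableSet_Ioi).2 (integrable_const _)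
    simp only [Pol.fac_large]
    rw [integral_sub (integrable_const 1) hint, integral_const, hsmall, measureReal_def,
      Measure.restrict_apply MeasurableSet.univ, univ_inter, Real.volume_Icc, hθa,
      ENNReal.toReal_ofReal hκθ.le, smul_eq_mul]
    ring

/-- **PER-TERM MIXTURE IDENTITY.**  Averaging the `m` sharp slot factors of ONE term over INDEPENDENT per-factor thresholds
`s_i ∈ [(1 − κ_i)θ_i, θ_i]` (product Lebesgue measure) gives the product of the (η) profile factors:
`∫ ∏_i fac_i(1[u_i < s_i]) ds = ∏_i κ_iθ_i · fac_i(linProfile κ_i (u_i/θ_i))` — Fubini in `m` variables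
(`MeasureTheory.integral_fintype_prod_eq_prod`).  (Lens seat g2; landed verbatim.) [folklore] -/
theorem sharpMixture_prod_eq_profile_prod {m : ℕ} (pol : Fin m → Pol) (κ θ u : Fin m → ℝ)
    (hκ0 : ∀ i, 0 < κ i) (hθ : ∀ i, 0 < θ i) :
    ∫ s : Fin m → ℝ, ∏ i, (pol i).fac (smallInd (u i) (s i))
        ∂(Measure.pi fun i => volume.restrict (Icc ((1 - κ i) * θ i) (θ i)))
      = ∏ i, (κ i * θ i * (pol i).fac (linProfile (κ i) (u i / θ i))) := by
  rw [MeasureTheory.integral_fintype_prod_eq_prod (𝕜 := ℝ) (E := fun _ => ℝ)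
    (fun i x => (pol i).fac (smallInd (u i) x))]
  exact Finset.prod_congr rfl fun i _ => integral_fac_smallInd (pol i) (hκ0 i) (hθ i) (u i)

/-! ## §2 Linear transports: single-run facts UNIFORM over the threshold vector pass to the λ-averages

Dictionary.  Per step `K` the run's occurrences carry ONE common threshold vector `λ` in a measurable space `Λ` with a finite (in the
application: probability) law `P` — the product of the per-occurrence uniform laws; each term reads the sub-vector of its own factors, and the
carriers are `X τ = ∫ Xs τ λ ∂P`.  Print's single-run inequalities between finite sums of term weights — the decompositions of unity E1∕E2,
King's relative bad-class bound `Σ_{Bad} ≤ W · Σ_T` (`T4WeightBudget.RelWeightBound`), the large-field rates — are LINEAR in the weights,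
so if they hold at EVERY admissible `λ` (which `T4LipschitzCutoff` §5∕§7 certifies: the admissibility lemmas are the worst case over
independent multipliers) they hold for the averages. -/

section Transport

variable {Λ : Type*} [MeasurableSpace Λ] {ι : Type*}

/-- averaging preserves linear inequalities between finite sums: if `Σ_{τ ∈ B} f τ λ ≤ W · Σ_{τ ∈ T} f τ λ` for `P`-a.e. `λ` and every
`f τ` is `P`-integrable, then `Σ_{τ ∈ B} ∫ f τ ∂P ≤ W · Σ_{τ ∈ T} ∫ f τ ∂P`. [folklore] -/
theorem integral_sum_le_of_forall (P : Measure Λ) (B T : Finset ι) (f : ι → Λ → ℝ) (W : ℝ)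
    (hB : ∀ τ ∈ B, Integrable (f τ) P) (hT : ∀ τ ∈ T, Integrable (f τ) P)
    (h : ∀ᵐ l ∂P, ∑ τ ∈ B, f τ l ≤ W * ∑ τ ∈ T, f τ l) :
    ∑ τ ∈ B, ∫ l, f τ l ∂P ≤ W * ∑ τ ∈ T, ∫ l, f τ l ∂P := by
  rw [← integral_finsetSum B hB, ← integral_finsetSum T hT, ← integral_const_mul]
  exact integral_mono_ae (integrable_finsetSum B hB) ((integrable_finsetSum T hT).const_mul W) h

/-- **A RELATIVE CLASS BOUND PASSES TO THE MIXTURE.**  If the carriers are λ-averages, `X τ = ∫ Xs τ λ ∂P` on `T`, and the sharp weights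
obey `Σ_{τ ∈ Bad} Xs τ λ ≤ W · Σ_{τ ∈ T} Xs τ λ` for `P`-almost every threshold vector `λ` (`Bad ⊆ T`, integrable sharp weights), then
`Σ_{τ ∈ Bad} X τ ≤ W · Σ_{τ ∈ T} X τ` — the `RelWeightBound`-shaped field for the mixture carriers. [folklore] -/
theorem relBound_mixture_of_forall (P : Measure Λ) {T Bad : Finset ι} (hBad : Bad ⊆ T) (Xs : ι → Λ → ℝ) (X : ι → ℝ) (W : ℝ)
    (hint : ∀ τ ∈ T, Integrable (Xs τ) P) (hX : ∀ τ ∈ T, X τ = ∫ l, Xs τ l ∂P)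
    (h : ∀ᵐ l ∂P, ∑ τ ∈ Bad, Xs τ l ≤ W * ∑ τ ∈ T, Xs τ l) :
    ∑ τ ∈ Bad, X τ ≤ W * ∑ τ ∈ T, X τ := by
  rw [Finset.sum_congr rfl fun τ hτ => hX τ (hBad hτ), Finset.sum_congr rfl fun τ hτ => hX τ hτ]
  exact integral_sum_le_of_forall P Bad T Xs W (fun τ hτ => hint τ (hBad hτ)) hint h

/-- **A POINTWISE BOUND PASSES TO THE AVERAGE.**  If `Xs λ ≤ b` for `P`-a.e. `λ` and `Xs` is integrable, then the normalised average obeys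
`(P univ)⁻¹ · ∫ Xs ∂P ≤ b` (for a finite measure with `P univ ≠ 0`; e.g. uniform large-field rates of print at admissibly lowered
thresholds transfer to the mixture carriers). [folklore] -/
theorem mixture_le_of_forall_le (P : Measure Λ) [IsFiniteMeasure P] (hP : P univ ≠ 0) {Xs : Λ → ℝ} {b : ℝ}
    (hint : Integrable Xs P) (h : ∀ᵐ l ∂P, Xs l ≤ b) :
    ((P univ).toReal)⁻¹ * ∫ l, Xs l ∂P ≤ b := by
  have hmass : 0 < (P univ).toReal := ENNReal.toReal_pos hP (measure_ne_top P _)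
  have hle : ∫ l, Xs l ∂P ≤ ∫ _l, b ∂P := integral_mono_ae hint (integrable_const b) h
  rw [integral_const, smul_eq_mul, measureReal_def] at hle
  rw [inv_mul_le_iff₀ hmass]
  linarith

end Transport

end Summit.QuantumFields.YangMills.Theorems.N21ThresholdMixture

end
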